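/-
B2b (LevelGradedCohnUmans, decidable (m,k) = (2,1) cell) — gen 18.
**The `(2,1)` cell is EMPTY at every prime — by theorem.**

VALUE = THEOREM / DECIDABLE VERDICT on one cell, NOT summit progress; the crux item
`SubgroupIdentityDesigns` is untouched and remains open.
Report: `run/shared/lean/b2b/levelgraded-cu/ORACLE-g18.md`.
-/
import Mathlib
import Summits.MatrixMultiplication.MatrixMultiplication.Theorems.SubgroupIdentityDesigns.Negative.CellTwoOneVerdict
import Summits.MatrixMultiplication.MatrixMultiplication.Theorems.SubgroupIdentityDesigns.Negative.LargePfreeMember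

/-!
# The `(2,1)` cell of `SubgroupIdentityDesigns` is empty at every prime

**`cellTwoOne_empty_all`**: for EVERY prime `p` and every `0 < ε ≤ 1`, no subgroup triple
`(H₁, H₂, H₃)` of `GL₂(𝔽_p)` with the TPP and a Fourier-rank-`≤ 1` identity design satisfies the
level-one budget inequality `budget p 2 1 (2+ε) < (|H₁||H₂||H₃|)^{(2+ε)/3}`; equivalently
(`no_crux_instance_two_one`) the crux's own `(m,k) = (2,1)` clause is unsatisfiable verbatim.

Proof.  `CellTwoOneVerdict.levelOne_witness_verdict` (gen 13–17) reduces any witness to `p = 31`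
and the residual profile `E ∋ -1`, `|E| = 120`, `|E Z / Z| = 60`, `{|S_A|, |S_B|} = {3, 5}`.  The
scalar parts then have orders `2 · 3 · 5 = 30 = p - 1`, so they cover the centre (`scalar_cover`),
and the member `E` is `31`-free with projective image `60 > 32 = p + 1`: the LARGE `p`-FREE MEMBER
criterion `LargePfreeMember.no_levelOne_design_of_large_pfree_memᵢ` (pigeonhole fixers in `E Z`,
`|E Z| = 1800 > 960 = 31² - 1`, + the faithful determinant character of `Fixers`) forbids the
identity design in each of the three positions of `E`.  This replaces the gen-16 exhaustive census
(kit `j126482`, 45 720 TPP triples, DATA) by a theorem and closes the last non-theorem point of the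
cell.  Nothing here bears on the summit: the crux asks for SOME `(p, m, k)`; one cell is decided.
-/

set_option linter.dupNamespace false

noncomputable section

open scoped Classical
open Summit.MatrixMultiplication.MatrixMultiplication.Theorems.LieRankDesigns.Negative (GLm Mat budget)
open Literature.Barriers.MatrixMultiplication (SubgroupTPP)

namespace Summit.MatrixMultiplication.MatrixMultiplication.Theorems.SubgroupIdentityDesigns.Negative

section CellTwoOneEmpty

variable {p : ℕ} [hp : Fact p.Prime]

/-- **The residual profile carries no design.**  At `p = 31`: if `E ∋ -1` has `|E| = 120` and
projective image `60`, the scalar parts of `A`, `B` have orders `{3, 5}`, and `(E, A, B)` placed in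
any of the three positions of `E` form a subgroup-TPP triple `(K₁, K₂, K₃)`, then `(K₁, K₂, K₃)`
has no level-one identity design. -/
theorem no_design_of_residual_profile (hp31 : p = 31) {E A B K₁ K₂ K₃ : Subgroup (GLm p 2)}
    (hpos : (E = K₁ ∧ A = K₂ ∧ B = K₃) ∨ (E = K₂ ∧ A = K₁ ∧ B = K₃) ∨ (E = K₃ ∧ A = K₁ ∧ B = K₂))
    (hE : Nat.card E = 120) (himg : Nat.card (E.map (QuotientGroup.mk' (scalarHom p 2).range)) = 60)
    (hAB : Nat.card (A.comap (scalarHom p 2)) * Nat.card (B.comap (scalarHom p 2)) = 15)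
    (htpp : SubgroupTPP K₁ K₂ K₃) :
    ¬ ∃ c : Mat p 2 → ℂ, (∀ M, 1 < M.rank → c M = 0) ∧
      (∑ M, c M * ZMod.stdAddChar (Matrix.trace (M * ((1 : GLm p 2) : Mat p 2)))) = 1 ∧
      ∀ a ∈ K₁, ∀ b ∈ K₂, ∀ g ∈ K₃, a * b * g ≠ 1 →
        (∑ M, c M *
          ZMod.stdAddChar (Matrix.trace (M * ((a * b * g : GLm p 2) : Mat p 2)))) = 0 := by
  -- the scalar part of `E` has order `120 / 60 = 2`
  have hSE : Nat.card (E.comap (scalarHom p 2)) = 2 := by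
    have h := card_eq_scalar_mul_card_image E
    rw [hE, himg] at h
    omega
  have hEp : ¬ p ∣ Nat.card E := by
    rw [hE, hp31]; norm_num
  have hbig : p + 1 < Nat.card (E.map (QuotientGroup.mk' (scalarHom p 2).range)) := by
    rw [himg]; omega
  rcases hpos with ⟨h₁, h₂, h₃⟩ | ⟨h₂, h₁, h₃⟩ | ⟨h₃, h₁, h₂⟩
  · have hfull : Nat.card (K₁.comap (scalarHom p 2)) * Nat.card (K₂.comap (scalarHom p 2)) *
        Nat.card (K₃.comap (scalarHom p 2)) = p - 1 := by
      rw [← h₁, ← h₂, ← h₃, hSE, mul_assoc, hAB]; omega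
    exact no_levelOne_design_of_large_pfree_mem₁ E h₁.le (scalar_cover htpp hfull) hEp hbig
  · have hfull : Nat.card (K₁.comap (scalarHom p 2)) * Nat.card (K₂.comap (scalarHom p 2)) *
        Nat.card (K₃.comap (scalarHom p 2)) = p - 1 := by
      rw [← h₁, ← h₂, ← h₃, hSE, mul_comm _ 2, mul_assoc, hAB]; omega
    exact no_levelOne_design_of_large_pfree_mem₂ E h₂.le (scalar_cover htpp hfull) hEp hbig
  · have hfull : Nat.card (K₁.comap (scalarHom p 2)) * Nat.card (K₂.comap (scalarHom p 2)) *
        Nat.card (K₃.comap (scalarHom p 2)) = p - 1 := by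
      rw [← h₁, ← h₂, ← h₃, hSE, hAB]; omega
    exact no_levelOne_design_of_large_pfree_mem₃ E h₃.le (scalar_cover htpp hfull) hEp hbig

/-- **THE `(2,1)` CELL IS EMPTY AT EVERY PRIME.**  For every prime `p` and `0 < ε ≤ 1`, a
subgroup-TPP triple of `GL₂(𝔽_p)` with a Fourier-rank-`≤ 1` identity design never satisfies the
level-one budget inequality.  Decidable verdict on one cell — NOT summit progress. -/
theorem cellTwoOne_empty_all {ε : ℝ} (hε : 0 < ε) (hε1 : ε ≤ 1)
    {H₁ H₂ H₃ : Subgroup (GLm p 2)} (htpp : SubgroupTPP H₁ H₂ H₃)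
    (hdesign : ∃ c : Mat p 2 → ℂ, (∀ M, 1 < M.rank → c M = 0) ∧
      (∑ M, c M * ZMod.stdAddChar (Matrix.trace (M * ((1 : GLm p 2) : Mat p 2)))) = 1 ∧
      ∀ a ∈ H₁, ∀ b ∈ H₂, ∀ g ∈ H₃, a * b * g ≠ 1 →
        (∑ M, c M *
          ZMod.stdAddChar (Matrix.trace (M * ((a * b * g : GLm p 2) : Mat p 2)))) = 0) :
    ¬ budget p 2 1 (2 + ε) <
      ((Nat.card H₁ * Nat.card H₂ * Nat.card H₃ : ℕ) : ℝ) ^ ((2 + ε) / 3) := by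
  intro hwit
  obtain ⟨hp31, E, A, B, hperm, -, hE, himg, -, -, -, -, hnum⟩ :=
    levelOne_witness_verdict hε hε1 htpp hdesign hwit
  have hAB : Nat.card (A.comap (scalarHom p 2)) * Nat.card (B.comap (scalarHom p 2)) = 15 := by
    rcases hnum with ⟨-, hzA, -, hzB⟩ | ⟨-, hzA, -, hzB⟩ <;> rw [hzA, hzB]
  exact no_design_of_residual_profile hp31 hperm hE himg hAB htpp hdesign

/-- **The crux's own `(m,k) = (2,1)` clause, verbatim, is unsatisfiable at every prime for
`0 < ε ≤ 1`** (definitional unfolding of `budget`).  One cell of the `(p, m, k)` grid decided; the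
crux `SubgroupIdentityDesigns` (SOME cell) is untouched. -/
theorem no_crux_instance_two_one {ε : ℝ} (hε : 0 < ε) (hε1 : ε ≤ 1)
    (H₁ H₂ H₃ : Subgroup (Matrix.GeneralLinearGroup (Fin 2) (ZMod p))) :
    ¬ (Literature.Barriers.MatrixMultiplication.SubgroupTPP H₁ H₂ H₃ ∧
      (∃ c : Matrix (Fin 2) (Fin 2) (ZMod p) → ℂ, (∀ M, 1 < M.rank → c M = 0) ∧
        (∑ M : Matrix (Fin 2) (Fin 2) (ZMod p), c M * ZMod.stdAddChar (Matrix.trace (M *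
          ((1 : Matrix.GeneralLinearGroup (Fin 2) (ZMod p)) : Matrix (Fin 2) (Fin 2) (ZMod p)))))
          = 1 ∧
        ∀ a ∈ H₁, ∀ b ∈ H₂, ∀ g ∈ H₃, a * b * g ≠ 1 →
          (∑ M : Matrix (Fin 2) (Fin 2) (ZMod p), c M * ZMod.stdAddChar (Matrix.trace (M *
            ((a * b * g : Matrix.GeneralLinearGroup (Fin 2) (ZMod p)) :
              Matrix (Fin 2) (Fin 2) (ZMod p))))) = 0) ∧
      (∑ᶠ χ ∈ Literature.RepresentationTheory.FiniteGroups.irrChars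
          (Matrix.GeneralLinearGroup (Fin 2) (ZMod p)) ∩
          {f | ∃ c : Matrix (Fin 2) (Fin 2) (ZMod p) → ℂ, (∀ M, 1 < M.rank → c M = 0) ∧
            ∀ g : Matrix.GeneralLinearGroup (Fin 2) (ZMod p), f g =
              ∑ M : Matrix (Fin 2) (Fin 2) (ZMod p), c M * ZMod.stdAddChar
                (Matrix.trace (M * (g : Matrix (Fin 2) (Fin 2) (ZMod p))))},
        (χ 1).re ^ (2 + ε)) <
        ((Nat.card H₁ * Nat.card H₂ * Nat.card H₃ : ℕ) : ℝ) ^ ((2 + ε) / 3)) := by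
  rintro ⟨htpp, hdesign, hlt⟩
  exact cellTwoOne_empty_all hε hε1 htpp hdesign hlt

/-- **No `(2,1)` instance of the crux, packaged over all primes**: for `0 < ε ≤ 1` there is no
prime `p` and no subgroup triple of `GL₂(𝔽_p)` witnessing `SubgroupIdentityDesigns` at
`(m,k) = (2,1)`. -/
theorem no_crux_instance_two_one_all {ε : ℝ} (hε : 0 < ε) (hε1 : ε ≤ 1) :
    ¬ ∃ (q : ℕ) (_ : Fact q.Prime)
      (H₁ H₂ H₃ : Subgroup (Matrix.GeneralLinearGroup (Fin 2) (ZMod q))),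
      Literature.Barriers.MatrixMultiplication.SubgroupTPP H₁ H₂ H₃ ∧
      (∃ c : Matrix (Fin 2) (Fin 2) (ZMod q) → ℂ, (∀ M, 1 < M.rank → c M = 0) ∧
        (∑ M : Matrix (Fin 2) (Fin 2) (ZMod q), c M * ZMod.stdAddChar (Matrix.trace (M *
          ((1 : Matrix.GeneralLinearGroup (Fin 2) (ZMod q)) : Matrix (Fin 2) (Fin 2) (ZMod q)))))
          = 1 ∧
        ∀ a ∈ H₁, ∀ b ∈ H₂, ∀ g ∈ H₃, a * b * g ≠ 1 →
          (∑ M : Matrix (Fin 2) (Fin 2) (ZMod q), c M * ZMod.stdAddChar (Matrix.trace (M *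
            ((a * b * g : Matrix.GeneralLinearGroup (Fin 2) (ZMod q)) :
              Matrix (Fin 2) (Fin 2) (ZMod q))))) = 0) ∧
      (∑ᶠ χ ∈ Literature.RepresentationTheory.FiniteGroups.irrChars
          (Matrix.GeneralLinearGroup (Fin 2) (ZMod q)) ∩
          {f | ∃ c : Matrix (Fin 2) (Fin 2) (ZMod q) → ℂ, (∀ M, 1 < M.rank → c M = 0) ∧
            ∀ g : Matrix.GeneralLinearGroup (Fin 2) (ZMod q), f g =
              ∑ M : Matrix (Fin 2) (Fin 2) (ZMod q), c M * ZMod.stdAddChar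
                (Matrix.trace (M * (g : Matrix (Fin 2) (Fin 2) (ZMod q))))},
        (χ 1).re ^ (2 + ε)) <
        ((Nat.card H₁ * Nat.card H₂ * Nat.card H₃ : ℕ) : ℝ) ^ ((2 + ε) / 3) := by
  rintro ⟨q, hq, H₁, H₂, H₃, h⟩
  exact no_crux_instance_two_one (p := q) hε hε1 H₁ H₂ H₃ h

end CellTwoOneEmpty

end Summit.MatrixMultiplication.MatrixMultiplication.Theorems.SubgroupIdentityDesigns.Negative
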